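import Summits.NavierStokesRegularity.OSWSelfSimilar.OSWMechanismGlobalBranch07
import HarnessLib

/-!
# OSW self-similar mechanism, companion module (MECHANISM.md §§29–34: THEOREMS M32–M39) — part 08 of 09

1-D model (gCLM/OSW), computer-assisted; not Euler/NS.  Filed under `Summits/NavierStokesRegularity/OSWSelfSimilar/` by a prover-role courier on behalf of the
mechanism seat pub-oswblow-mech (planner-pub-oswblow-mech-g29-0), cell pub-oswblow (host summit NavierStokesRegularity); the gate admits the path but
not role planner.  CONTENT = the staged transcript `pub-oswblow-mech/lean/OSWMechanismGlobalBranch.lean` (sha256 4e5de3f87ec94598…,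
2998 lines), source lines 2579–2939, UNCHANGED except: (i) namespace prefix `OSWSelfSimilar.Mechanism` → `Summit.NavierStokesRegularity.OSWSelfSimilar.Mechanism`;
(ii) the frames open at the cut (section (anonymous) › namespace Summit.NavierStokesRegularity.OSWSelfSimilar.Mechanism.ChenArcShape) are re-opened above the body with their `open` commands replayed, and closed
at the end; (iii) this docstring.  Generated by `pub-oswblow-mech/lean/courier/make_split.py`; the parts must be filed IN ORDER
(each imports its predecessor).  First/last declarations here: `chi0_le_of_psi_deriv_lb` … `shapeSet` (23 in this part).
AI-written transcript; kernel-checked on the farm as ONE file before splitting (see the kit's CHECKS); to be checked, not trusted.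
-/

noncomputable section
open Complex Set Filter
open scoped Topology
open Literature.Analysis.FluidPDE.OkamotoSakajoWunsch2008
namespace Summit.NavierStokesRegularity.OSWSelfSimilar.Mechanism.ChenArcShape
open Summit.NavierStokesRegularity.OSWSelfSimilar.Mechanism.GlobalBranch Summit.NavierStokesRegularity.OSWSelfSimilar.Mechanism.ChordSlope Summit.NavierStokesRegularity.OSWSelfSimilar.Mechanism.SourceDefect
open Summit.NavierStokesRegularity.OSWSelfSimilar.Mechanism.FirstCritFloor Summit.NavierStokesRegularity.OSWSelfSimilar.Mechanism.EffectiveFloor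
open Set

/-- (34.2′): with `0 < x < π`, `χ⁰ = −sin x · ψ′` and LEMMA 23.4's `ψ′ ≥ x/2 + ½ tan(x/2)`:
`χ⁰ ≤ −sin²(x/2) − x sin x/2` (so `χ⁰ → −2` at `π⁻` and `χ⁰ ≤ −2ψ₂x² + O(x⁴)` is consistent at `0`). -/
theorem chi0_le_of_psi_deriv_lb (x χ0 ψ' : ℝ) (hx0 : 0 < x) (hxπ : x < Real.pi)
    (hχ : χ0 = -(Real.sin x * ψ')) (hψ : x / 2 + Real.tan (x / 2) / 2 ≤ ψ') :
    χ0 ≤ -Real.sin (x / 2) ^ 2 - x * Real.sin x / 2 := by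
  have hs : 0 < Real.sin x := Real.sin_pos_of_pos_of_lt_pi hx0 hxπ
  have hc : Real.cos (x / 2) ≠ 0 := by
    have : 0 < Real.cos (x / 2) := Real.cos_pos_of_mem_Ioo ⟨by linarith, by linarith⟩
    exact ne_of_gt this
  have hid := half_sin_mul_tan_half x hc
  have hm : Real.sin x * (x / 2 + Real.tan (x / 2) / 2) ≤ Real.sin x * ψ' :=
    mul_le_mul_of_nonneg_left hψ hs.le
  rw [hχ]
  nlinarith [hid, hm]

/-- `x cos x ≤ sin x` on `[0, π/2]`; with the reflection `x ↦ π − x` this is `min(x, π−x)·|cot x| ≤ 1` on `(0,π)`,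
the elementary bound used in LEMMA 34.3 (i) to control `(Γ_ε − Γ⁰) cot x` by `sup|E_ε − E⁰|`. -/
theorem mul_cos_le_sin (x : ℝ) (h0 : 0 ≤ x) (h1 : x ≤ Real.pi / 2) : x * Real.cos x ≤ Real.sin x := by
  rcases eq_or_lt_of_le h0 with h | hpos
  · rw [← h]; simp
  rcases eq_or_lt_of_le h1 with h | hlt
  · rw [h]; simp
  have hc : 0 < Real.cos x := Real.cos_pos_of_mem_Ioo ⟨by linarith [Real.pi_pos], hlt⟩
  have ht : x < Real.tan x := Real.lt_tan hpos hlt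
  rw [Real.tan_eq_sin_div_cos, lt_div_iff₀ hc] at ht
  linarith

/-- The reflected form: `(π − x)·|cos x| ≤ sin x` for `π/2 ≤ x ≤ π`. -/
theorem sub_mul_abs_cos_le_sin (x : ℝ) (h0 : Real.pi / 2 ≤ x) (h1 : x ≤ Real.pi) :
    (Real.pi - x) * |Real.cos x| ≤ Real.sin x := by
  have hy0 : 0 ≤ Real.pi - x := by linarith
  have hy1 : Real.pi - x ≤ Real.pi / 2 := by linarith
  have h := mul_cos_le_sin (Real.pi - x) hy0 hy1
  rw [Real.cos_pi_sub, Real.sin_pi_sub] at h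
  have hcos : Real.cos x ≤ 0 := Real.cos_nonpos_of_pi_div_two_le_of_le h0 (by linarith [Real.pi_pos])
  rw [abs_of_nonpos hcos]
  linarith

/-! ### The even-`C²` Taylor bound at the source (THEOREM M39 (a), source layer) -/

/-- First-order step: `D′(0) = 0` and `|D″| ≤ η` on `[0, X]` give `|D′(x)| ≤ η x` on `[0, X]`. -/
theorem deriv_bound_of_second (D' D'' : ℝ → ℝ) (X η : ℝ)
    (hD' : ∀ x ∈ Icc 0 X, HasDerivAt D' (D'' x) x) (h0' : D' 0 = 0) (hη : ∀ x ∈ Icc 0 X, |D'' x| ≤ η) :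
    ∀ x ∈ Icc 0 X, |D' x| ≤ η * x := by
  have hcont : ContinuousOn D' (Icc 0 X) := fun x hx => (hD' x hx).continuousAt.continuousWithinAt
  have hint : interior (Icc 0 X) ⊆ Icc 0 X := interior_subset
  -- `q₊ = η t − D′` and `q₋ = η t + D′` are monotone on `[0, X]`.
  have hq1 : MonotoneOn (fun t => η * t - D' t) (Icc 0 X) := by
    apply monotoneOn_of_deriv_nonneg (convex_Icc 0 X)
    · exact (continuousOn_const.mul continuousOn_id).sub hcont
    · intro x hx
      exact (((hasDerivAt_id x).const_mul η).sub (hD' x (hint hx))).differentiableAt.differentiableWithinAt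
    · intro x hx
      have hd : HasDerivAt (fun t => η * t - D' t) (η * 1 - D'' x) x :=
        ((hasDerivAt_id x).const_mul η).sub (hD' x (hint hx))
      rw [hd.deriv]
      have := hη x (hint hx)
      linarith [le_abs_self (D'' x)]
  have hq2 : MonotoneOn (fun t => η * t + D' t) (Icc 0 X) := by
    apply monotoneOn_of_deriv_nonneg (convex_Icc 0 X)
    · exact (continuousOn_const.mul continuousOn_id).add hcont
    · intro x hx
      exact (((hasDerivAt_id x).const_mul η).add (hD' x (hint hx))).differentiableAt.differentiableWithinAt
    · intro x hx
      have hd : HasDerivAt (fun t => η * t + D' t) (η * 1 + D'' x) x :=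
        ((hasDerivAt_id x).const_mul η).add (hD' x (hint hx))
      rw [hd.deriv]
      have := hη x (hint hx)
      linarith [neg_abs_le (D'' x)]
  intro x hx
  have h0mem : (0 : ℝ) ∈ Icc 0 X := ⟨le_rfl, le_trans hx.1 hx.2⟩
  have a1 := hq1 h0mem hx hx.1
  have a2 := hq2 h0mem hx hx.1
  simp only [mul_zero, h0', sub_zero, add_zero] at a1 a2
  rw [abs_le]
  constructor <;> linarith

/-- **The even-`C²` Taylor bound:** `D(0) = D′(0) = 0` and `|D″| ≤ η` on `[0, X]` give `|D(x)| ≤ η x²/2` on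
`[0, X]`.  In THEOREM M39 (a) it is applied to `D = χ_ε − χ⁰` (even, `C²` on `[−r′, r′]` by LEMMA 34.2, with
`η = η(ε) = sup_{[0,1]}|D″| → 0` by LEMMA 34.3 (ii)). -/
theorem c2_taylor_bound (D D' D'' : ℝ → ℝ) (X η : ℝ)
    (hD : ∀ x ∈ Icc 0 X, HasDerivAt D (D' x) x) (hD' : ∀ x ∈ Icc 0 X, HasDerivAt D' (D'' x) x)
    (h0 : D 0 = 0) (h0' : D' 0 = 0) (hη : ∀ x ∈ Icc 0 X, |D'' x| ≤ η) :
    ∀ x ∈ Icc 0 X, |D x| ≤ η * x ^ 2 / 2 := by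
  have hb := deriv_bound_of_second D' D'' X η hD' h0' hη
  have hcont : ContinuousOn D (Icc 0 X) := fun x hx => (hD x hx).continuousAt.continuousWithinAt
  have hint : interior (Icc 0 X) ⊆ Icc 0 X := interior_subset
  have hpoly : ∀ x : ℝ, HasDerivAt (fun t : ℝ => η * t ^ 2 / 2) (η * x) x := by
    intro x
    have h1 : HasDerivAt (fun t : ℝ => t ^ 2) (2 * x) x := by
      simpa using hasDerivAt_pow 2 x
    have h2 : HasDerivAt (fun t : ℝ => η * t ^ 2 / 2) (η * (2 * x) / 2) x := (h1.const_mul η).div_const 2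
    exact h2.congr_deriv (by ring)
  have hpc : ContinuousOn (fun t : ℝ => η * t ^ 2 / 2) (Icc 0 X) :=
    fun x _ => (hpoly x).continuousAt.continuousWithinAt
  have hp1 : MonotoneOn (fun t => η * t ^ 2 / 2 - D t) (Icc 0 X) := by
    apply monotoneOn_of_deriv_nonneg (convex_Icc 0 X)
    · exact hpc.sub hcont
    · intro x hx
      exact ((hpoly x).sub (hD x (hint hx))).differentiableAt.differentiableWithinAt
    · intro x hx
      have hd : HasDerivAt (fun t => η * t ^ 2 / 2 - D t) (η * x - D' x) x := (hpoly x).sub (hD x (hint hx))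
      rw [hd.deriv]
      have := hb x (hint hx)
      linarith [le_abs_self (D' x)]
  have hp2 : MonotoneOn (fun t => η * t ^ 2 / 2 + D t) (Icc 0 X) := by
    apply monotoneOn_of_deriv_nonneg (convex_Icc 0 X)
    · exact hpc.add hcont
    · intro x hx
      exact ((hpoly x).add (hD x (hint hx))).differentiableAt.differentiableWithinAt
    · intro x hx
      have hd : HasDerivAt (fun t => η * t ^ 2 / 2 + D t) (η * x + D' x) x := (hpoly x).add (hD x (hint hx))
      rw [hd.deriv]
      have := hb x (hint hx)
      linarith [neg_abs_le (D' x)]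
  intro x hx
  have h0mem : (0 : ℝ) ∈ Icc 0 X := ⟨le_rfl, le_trans hx.1 hx.2⟩
  have a1 := hp1 h0mem hx hx.1
  have a2 := hp2 h0mem hx hx.1
  simp only [h0] at a1 a2
  norm_num at a1 a2
  rw [abs_le]
  constructor <;> linarith

/-! ### THEOREM M39 (a): the envelope `χ_ε ≤ −½ sin²(x/2)` on `(0,π)`, in two pieces -/

/-- **Source layer and near bulk (`0 < x ≤ 1`):** from (34.2′), Jordan's inequality `sin x ≥ (2/π)x` (so
`x sin x/2 ≥ x²/π`), the Taylor bound `|χ − χ⁰| ≤ η x²/2` and `η ≤ 2/π`: `χ ≤ −½ sin²(x/2)`. -/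
theorem source_margin (x χ χ0 η : ℝ) (hx0 : 0 < x) (hx1 : x ≤ 1)
    (hχ0 : χ0 ≤ -Real.sin (x / 2) ^ 2 - x * Real.sin x / 2) (hd : |χ - χ0| ≤ η * x ^ 2 / 2)
    (hη : η ≤ 2 / Real.pi) : χ ≤ -(Real.sin (x / 2) ^ 2) / 2 := by
  have hπ := Real.pi_gt_three
  have hxπ2 : x ≤ Real.pi / 2 := by linarith
  have hj : 2 / Real.pi * x ≤ Real.sin x := Real.mul_le_sin hx0.le hxπ2
  have h1 : x ^ 2 / Real.pi ≤ x * Real.sin x / 2 := by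
    have hm := mul_le_mul_of_nonneg_left hj hx0.le
    have e : x * (2 / Real.pi * x) = 2 * (x ^ 2 / Real.pi) := by ring
    linarith
  have h2 : χ - χ0 ≤ η * x ^ 2 / 2 := le_trans (le_abs_self _) hd
  have h3 : η * x ^ 2 / 2 ≤ x ^ 2 / Real.pi := by
    have hx2 : 0 ≤ x ^ 2 := sq_nonneg x
    have hm := mul_le_mul_of_nonneg_left hη hx2
    have e : x ^ 2 * (2 / Real.pi) = 2 * (x ^ 2 / Real.pi) := by ring
    nlinarith
  have hS : 0 ≤ Real.sin (x / 2) ^ 2 := sq_nonneg _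
  linarith

/-- **Bulk and sink layer (`1 ≤ x < π`):** from `χ⁰ ≤ −sin²(x/2)`, monotonicity `sin²(x/2) ≥ sin²(1/2)` and the
uniform bound `|χ − χ⁰| ≤ δ ≤ ½ sin²(1/2)` (LEMMA 34.3 (i) with `C₁ε ≤ ½ sin²(1/2)`): `χ ≤ −½ sin²(x/2)`. -/
theorem bulk_sink_margin (x χ χ0 δ : ℝ) (hx1 : 1 ≤ x) (hxπ : x < Real.pi)
    (hχ0 : χ0 ≤ -Real.sin (x / 2) ^ 2) (hd : |χ - χ0| ≤ δ) (hδ : δ ≤ Real.sin (1 / 2) ^ 2 / 2) :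
    χ ≤ -(Real.sin (x / 2) ^ 2) / 2 := by
  have hπ := Real.pi_gt_three
  have hmono : Real.sin (1 / 2) ≤ Real.sin (x / 2) :=
    Real.sin_le_sin_of_le_of_le_pi_div_two (by linarith) (by linarith) (by linarith)
  have hpos : 0 ≤ Real.sin (1 / 2) :=
    Real.sin_nonneg_of_nonneg_of_le_pi (by norm_num) (by linarith)
  have hsq : Real.sin (1 / 2) ^ 2 ≤ Real.sin (x / 2) ^ 2 := pow_le_pow_left₀ hpos hmono 2
  have h2 : χ - χ0 ≤ δ := le_trans (le_abs_self _) hd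
  linarith

/-- The two pieces glued: a pointwise statement of THEOREM M39 (a)'s envelope on `(0,π)`, with the analytic inputs
((34.2′) in the sharper form on `(0,1]`, the weaker `χ⁰ ≤ −sin²(x/2)` on `[1,π)`, and the two deviation bounds of
LEMMA 34.3) as hypotheses. -/
theorem chen_arc_envelope (χ χ0 : ℝ → ℝ) (η δ : ℝ) (hη : η ≤ 2 / Real.pi) (hδ : δ ≤ Real.sin (1 / 2) ^ 2 / 2)
    (henv : ∀ x ∈ Ioo 0 Real.pi, χ0 x ≤ -Real.sin (x / 2) ^ 2 - x * Real.sin x / 2)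
    (hsrc : ∀ x ∈ Ioc 0 (1 : ℝ), |χ x - χ0 x| ≤ η * x ^ 2 / 2)
    (hunif : ∀ x ∈ Ioo 0 Real.pi, |χ x - χ0 x| ≤ δ) :
    ∀ x ∈ Ioo 0 Real.pi, χ x ≤ -(Real.sin (x / 2) ^ 2) / 2 := by
  intro x hx
  rcases le_or_gt x 1 with h | h
  · exact source_margin x (χ x) (χ0 x) η hx.1 h (henv x hx) (hsrc x ⟨hx.1, h⟩) hη
  · have hs : 0 ≤ x * Real.sin x / 2 := by
      have := Real.sin_pos_of_pos_of_lt_pi hx.1 hx.2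
      have := hx.1
      positivity
    exact bulk_sink_margin x (χ x) (χ0 x) δ h.le hx.2 (by linarith [henv x hx]) (hunif x hx) hδ

/-! ### THEOREM M39 (a): strict monotonicity of `u = F/sin x` with a rate -/

/-- From the transport form (34.3) `a g u′ = u χ`, the envelope `χ ≤ −S₂/2` (`S₂ = sin²(x/2) = sin x·tan(x/2)/2`),
`u, a, g > 0`, `tan(x/2) ≥ 0` and `g ≤ (3/2)·A₀·sin x` ((24.4)): `−u′ ≥ u·tan(x/2)/(6 a A₀)` on `(0,π)`. -/
theorem neg_u_deriv_lb (a A0 g u u' χ sx S2 t : ℝ) (ha : 0 < a) (hA : 0 < A0) (hg : 0 < g) (hu : 0 < u)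
    (ht : 0 ≤ t) (hid : a * g * u' = u * χ) (hχ : χ ≤ -S2 / 2) (hS : S2 = sx * (t / 2))
    (hg' : g ≤ 3 / 2 * A0 * sx) : u * t / (6 * a * A0) ≤ -u' := by
  rw [div_le_iff₀ (by positivity)]
  -- (i) `a g (−u′) ≥ u S₂/2`
  have h1 : u * S2 / 2 ≤ a * g * (-u') := by nlinarith [mul_le_mul_of_nonneg_left hχ hu.le]
  -- (ii) `u S₂/2 · 6 A₀ = (3/2)·u·sx·t·A₀ ≥ u·t·g`
  have h2 : u * t * g ≤ u * S2 / 2 * (6 * A0) := by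
    rw [hS]
    have := mul_le_mul_of_nonneg_left hg' (mul_nonneg hu.le ht)
    nlinarith
  -- (iii) combine and cancel `g > 0`
  have h3 : u * t * g ≤ a * g * (-u') * (6 * A0) := le_trans h2 (by nlinarith [h1, hA])
  have h4 : (u * t) * g ≤ (-u' * (6 * a * A0)) * g := by nlinarith [h3]
  exact le_of_mul_le_mul_right h4 hg

/-! ### THEOREM M39 (b): the chord slope exceeds `1` near `a = 1` -/

/-- `d(0) = φ⁰′(0) = κ = ½ − 2 log 2 < 0` (`= −0.886…`). -/
theorem d0_neg : (1 : ℝ) / 2 - 2 * Real.log 2 < 0 := by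
  have := Real.log_two_gt_d9
  linarith

/-- `𝔰(ε) = 1 − ε d(ε) > 1` for `0 < ε` as soon as `|d(ε) − d(0)| ≤ Kε` with `Kε < 2 log 2 − ½`
(in particular for all small `ε > 0`, `d` being holomorphic at `0` by (34.6)). -/
theorem frak_s_gt_one (ε d K : ℝ) (hε : 0 < ε) (hd : |d - (1 / 2 - 2 * Real.log 2)| ≤ K * ε)
    (hK : K * ε < 2 * Real.log 2 - 1 / 2) : 1 < 1 - ε * d := by
  have h1 : d ≤ (1 / 2 - 2 * Real.log 2) + K * ε := by
    linarith [le_abs_self (d - (1 / 2 - 2 * Real.log 2))]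
  have h2 : d < 0 := by linarith
  nlinarith

/-! ### COROLLARY 34.5 (c): the exit parameter `σ_𝒮` -/

/-- **The order-theoretic skeleton of COROLLARY 34.5 (c).**  Let `T ⊆ ℝ` (`= {σ > 0 : f(σ) ∈ 𝒮}`) be relatively
closed in `(0,∞)` (every positive point of `closure T` lies in `T`; COROLLARY 34.5 (a)) and contain an initial
segment `(0, σ₀]` (THEOREM M39).  Then EITHER `(0,∞) ⊆ T` (the whole branch lies in `𝒮`), OR the exit parameter
`σ_𝒮 := sup{σ : (0,σ] ⊆ T}` is positive, `(0, σ_𝒮] ⊆ T` (in particular `σ_𝒮 ∈ T`), and `T` omits points above and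
arbitrarily close to `σ_𝒮`. -/
theorem exit_parameter_dichotomy (T : Set ℝ) (hcl : ∀ s : ℝ, 0 < s → s ∈ closure T → s ∈ T)
    (σ0 : ℝ) (hσ0 : 0 < σ0) (h0 : Ioc 0 σ0 ⊆ T) :
    Ioi 0 ⊆ T ∨ ∃ σS : ℝ, 0 < σS ∧ Ioc 0 σS ⊆ T ∧
      ∀ δ : ℝ, 0 < δ → ∃ σ : ℝ, σS < σ ∧ σ < σS + δ ∧ σ ∉ T := by
  classical
  set B : Set ℝ := {σ | 0 < σ ∧ Ioc 0 σ ⊆ T} with hB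
  have hB0 : σ0 ∈ B := ⟨hσ0, h0⟩
  have hne : B.Nonempty := ⟨σ0, hB0⟩
  by_cases hbdd : BddAbove B
  · right
    have hpos : 0 < sSup B := lt_of_lt_of_le hσ0 (le_csSup hbdd hB0)
    -- points strictly below `sSup B` are in `T`
    have hbelow : Ioo 0 (sSup B) ⊆ T := by
      intro y hy
      obtain ⟨σ, hσB, hyσ⟩ := exists_lt_of_lt_csSup hne hy.2
      exact hσB.2 ⟨hy.1, hyσ.le⟩
    -- `sSup B` itself is in `T` by relative closedness
    have htop : sSup B ∈ T := by
      apply hcl _ hpos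
      have hmem : sSup B ∈ closure (Ioo 0 (sSup B)) := by
        rw [closure_Ioo hpos.ne]
        exact ⟨hpos.le, le_rfl⟩
      exact closure_mono hbelow hmem
    have hIoc : Ioc 0 (sSup B) ⊆ T := by
      intro x hx
      rcases eq_or_lt_of_le hx.2 with heq | hlt
      · rw [heq]; exact htop
      · exact hbelow ⟨hx.1, hlt⟩
    refine ⟨sSup B, hpos, hIoc, ?_⟩
    intro δ hδ
    by_contra hcon
    push Not at hcon
    have hmem : sSup B + δ / 2 ∈ B := by
      refine ⟨by linarith, ?_⟩
      intro y hy
      rcases le_or_gt y (sSup B) with h | h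
      · exact hIoc ⟨hy.1, h⟩
      · exact hcon y h (by linarith [hy.2])
    have := le_csSup hbdd hmem
    linarith
  · left
    intro x hx
    rw [not_bddAbove_iff] at hbdd
    obtain ⟨σ, hσB, hxσ⟩ := hbdd x
    exact hσB.2 ⟨hx, hxσ.le⟩

/-! ### §34 typed: `u = F/sin x`, the transport defect `χ = Hf − 1 − a g cot x`, THEOREM M39 and COROLLARY 34.5 as named
statements on the typed branch family of v23, and the kernel-checked spines: the branch STARTS in `𝒮` (M39 (a)); the
chord slope `𝔰 → 1⁺` at the De Gregorio end (M39 (b) ⇒ REMARK (2) to THEOREM 30.3 answered); the set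
`𝒯 = {σ : f(σ) ∈ 𝒮}` is relatively closed in `(0,∞)` (COROLLARY 34.5 (a) + (22.16)); and the EXIT-PARAMETER DICHOTOMY of
COROLLARY 34.5 (c) (`exit_parameter_dichotomy` above, applied to `𝒯`).  LEMMA 34.1 (Privalov, pseudo-local), LEMMA 34.2
(the Fuchsian bootstrap at the source: uniform `C^{k,β}` bounds, holomorphy of `ε ↦ ∂ʲφ_ε(x₀)`) and LEMMA 34.3 (the rate
`sup|χ_ε − χ⁰| ≤ C₁ε`) are statements about M28's function spaces `W`, `X^{0,β}`, which are not in the typed vocabulary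
of this module: they are recorded in MECHANISM.md §34 and enter here only through their consequences `DefectContinuous`
(COROLLARY 34.5 (a)) and `ArcStrictlyInS` (THEOREM M39 (a)). -/

/-- `u = F/sin x` (`F = −f > 0` on `(0,π)` for negative profiles; `𝒮 = {u non-increasing}`, `InS`). -/
def uR (c : ℤ → ℂ) (x : ℝ) : ℝ := -fR c x / Real.sin x

/-- The transport defect of (22.16)/(34.1): `χ = Hf − 1 − a·g·cot x = Hf − 1 − a·g·cos x / sin x`
(`a g u′ = u χ` on `(0,π)`, (34.3)). -/
def chiR (a : ℝ) (c : ℤ → ℂ) (x : ℝ) : ℝ := HfR c x - 1 - a * gR c x * (Real.cos x / Real.sin x)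

/-- (22.16), typed as a property of the family (PROVED pen-and-paper, MECHANISM.md §22.9: for a negative class-(H) profile
`F > 0`, `g > 0` on `(0,π)` and `a g u′ = u χ`, so `u` is non-increasing iff `χ ≤ 0`). -/
def DefectCharacterisesS (aσ : ℝ → ℝ) (cσ : ℝ → ℤ → ℂ) : Prop :=
  ∀ σ : ℝ, 0 < σ → (InS (cσ σ) ↔ ∀ x ∈ Set.Ioo 0 Real.pi, chiR (aσ σ) (cσ σ) x ≤ 0)

/-- **COROLLARY 34.5 (a), typed (PROVED pen-and-paper, MECHANISM.md §34.5, from LEMMA 34.2 (a) at the source, Privalov and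
the explicit sink value `χ(σ,π) = −(1 + (1−a)B₀)`):** the transport defect is continuous along the branch in the sup norm
of `(0,π)`. -/
def DefectContinuous (aσ : ℝ → ℝ) (cσ : ℝ → ℤ → ℂ) : Prop :=
  ∀ σ₀ : ℝ, 0 < σ₀ → ∀ η : ℝ, 0 < η → ∃ δ : ℝ, 0 < δ ∧ ∀ σ : ℝ, 0 < σ → |σ - σ₀| < δ →
    ∀ x ∈ Set.Ioo 0 Real.pi, |chiR (aσ σ) (cσ σ) x - chiR (aσ σ₀) (cσ σ₀) x| < η

/-- **THEOREM 34.4 (a) = THEOREM M39 (a), typed (PROVED pen-and-paper, MECHANISM.md §34.4):** an initial segment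
`0 < σ ≤ ε_𝒮` of the branch (Chen's arc `a = 1 − σ`, `f_σ = ω_a/|c_{ω,a}|`) satisfies the STRICT transport envelope
`χ ≤ −½ sin²(x/2)` on all of `(0,π)` — source layer `x ≲ σ` and sink layer included —, `u = F/sin x` is strictly
decreasing on `(0,π)`, and `f_σ ∈ 𝒮₁ ⊂ 𝒮`. -/
def ArcStrictlyInS (aσ : ℝ → ℝ) (cσ : ℝ → ℤ → ℂ) : Prop :=
  ∃ εS : ℝ, 0 < εS ∧ ∀ σ : ℝ, 0 < σ → σ ≤ εS →
    (∀ x ∈ Set.Ioo 0 Real.pi, chiR (aσ σ) (cσ σ) x ≤ -(Real.sin (x / 2) ^ 2) / 2) ∧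
    StrictAntiOn (uR (cσ σ)) (Set.Ioo 0 Real.pi) ∧ InS1 (cσ σ)

/-- **THEOREM 34.4 (b) = THEOREM M39 (b), typed (PROVED pen-and-paper, MECHANISM.md §34.4, from LEMMA 34.2 (b)):** near the
De Gregorio end the blown-down chord slope is `𝔰(σ) = (1 − a)·|f_σ′(0)| = 1 − σ·d(σ)` with `d` real-analytic at `0` and
`d(0) = κ = ½ − 2 log 2`; i.e. `𝔰(σ) = 1 + (2 log 2 − ½)σ + O(σ²)`. -/
def ChordSlopeExpansion (aσ : ℝ → ℝ) (cσ : ℝ → ℤ → ℂ) : Prop :=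
  ∃ d : ℝ → ℝ, AnalyticAt ℝ d 0 ∧ d 0 = 1 / 2 - 2 * Real.log 2 ∧ ∃ ε₄ : ℝ, 0 < ε₄ ∧
    ∀ σ : ℝ, 0 < σ → σ < ε₄ → (1 - aσ σ) * (-deriv (fR (cσ σ)) 0) = 1 - σ * d σ

/-- **The v28 statement of this module's §34 block (typed shadow, parametric in `NegP`; all PROVED pen-and-paper in
MECHANISM.md §34):** for every Hölder exponent the negative branch continues as a branch family (M32) along which (22.16)
characterises `𝒮` by `χ ≤ 0`, the defect is sup-norm continuous (COROLLARY 34.5 (a)), an initial arc lies strictly in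
`𝒮₁ ⊂ 𝒮` (M39 (a)) and the chord slope has the convergent expansion of M39 (b). -/
def ChenArcShapeStatement (NegP : ℝ → (ℤ → ℂ) → Prop) : Prop :=
  ∀ β : NNReal, 0 < β → β < 1 → ∃ (aσ : ℝ → ℝ) (cσ : ℝ → ℤ → ℂ), BranchFamily NegP β aσ cσ ∧
    DefectCharacterisesS aσ cσ ∧ DefectContinuous aσ cσ ∧ ArcStrictlyInS aσ cσ ∧ ChordSlopeExpansion aσ cσ

/-! #### Kernel-checked consequences -/

/-- M39 (a) ⇒ the branch STARTS INSIDE `𝒮`: `{σ : f(σ) ∈ 𝒮} ⊇ (0, ε_𝒮]` (kernel-checked; `𝒮₁ ⊂ 𝒮`). -/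
theorem start_in_S {aσ : ℝ → ℝ} {cσ : ℝ → ℤ → ℂ} (hA : ArcStrictlyInS aσ cσ) :
    ∃ εS : ℝ, 0 < εS ∧ ∀ σ : ℝ, 0 < σ → σ ≤ εS → InS (cσ σ) := by
  obtain ⟨εS, hε, h⟩ := hA
  exact ⟨εS, hε, fun σ hσ hσ' => (h σ hσ hσ').2.2.1⟩

/-- M39 (b) ⇒ REMARK (2) to THEOREM 30.3 answered (kernel-checked): the blown-down chord slope tends to `1` at the De
Gregorio end, `𝔰(σ) → 1` as `σ → 0⁺`. -/
theorem chordSlope_tendsto_one {aσ : ℝ → ℝ} {cσ : ℝ → ℤ → ℂ} (hE : ChordSlopeExpansion aσ cσ) :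
    Tendsto (fun σ => (1 - aσ σ) * (-deriv (fR (cσ σ)) 0)) (𝓝[>] 0) (𝓝 1) := by
  obtain ⟨d, hd, _, ε₄, hε₄, h⟩ := hE
  have hc : ContinuousAt (fun σ : ℝ => 1 - σ * d σ) 0 :=
    continuousAt_const.sub (continuousAt_id.mul hd.continuousAt)
  have ht : Tendsto (fun σ : ℝ => 1 - σ * d σ) (𝓝[>] 0) (𝓝 1) := by
    have := hc.tendsto
    simp only [zero_mul, sub_zero] at this
    exact tendsto_nhdsWithin_of_tendsto_nhds this
  refine ht.congr' ?_
  have hmem : Set.Ioo (0 : ℝ) ε₄ ∈ 𝓝[>] (0 : ℝ) := Ioo_mem_nhdsGT hε₄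
  filter_upwards [hmem] with σ hσ
  exact (h σ hσ.1 hσ.2).symm

/-- M39 (b) ⇒ `𝔰 → 1⁺` STRICTLY FROM ABOVE (kernel-checked, using `d(0) = ½ − 2 log 2 < 0`, i.e. `log 2 > ¼`):
`𝔰(σ) > 1` for all small `σ > 0`. -/
theorem chordSlope_gt_one_eventually {aσ : ℝ → ℝ} {cσ : ℝ → ℤ → ℂ} (hE : ChordSlopeExpansion aσ cσ) :
    ∀ᶠ σ in 𝓝[>] 0, 1 < (1 - aσ σ) * (-deriv (fR (cσ σ)) 0) := by
  obtain ⟨d, hd, hd0, ε₄, hε₄, h⟩ := hE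
  have hneg : d 0 < 0 := by
    rw [hd0]; have := Real.log_two_gt_d9; linarith
  have hev : ∀ᶠ σ in 𝓝 (0 : ℝ), d σ < 0 := hd.continuousAt.eventually (gt_mem_nhds hneg)
  have hev' : ∀ᶠ σ in 𝓝[>] (0 : ℝ), d σ < 0 := eventually_nhdsWithin_of_eventually_nhds hev
  have hmem : Set.Ioo (0 : ℝ) ε₄ ∈ 𝓝[>] (0 : ℝ) := Ioo_mem_nhdsGT hε₄
  filter_upwards [hev', hmem] with σ hσd hσ
  rw [h σ hσ.1 hσ.2]
  nlinarith [hσ.1, hσd]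

/-- The parameter set `𝒯 = {σ > 0 : f(σ) ∈ 𝒮}` of COROLLARY 34.5. -/
def shapeSet (cσ : ℝ → ℤ → ℂ) : Set ℝ := {σ | 0 < σ ∧ InS (cσ σ)}

end Summit.NavierStokesRegularity.OSWSelfSimilar.Mechanism.ChenArcShape
end
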